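import Summits.BirchSwinnertonDyer.Rank1Residual.Supersingular.KuriharaTwistSymbolKurihara
import Summits.BirchSwinnertonDyer.Rank1Residual.Supersingular.X6KuriharaRoute
import Summits.BirchSwinnertonDyer.Rank1Residual.Supersingular.X7KuriharaRoute
import HarnessLib

/-!
# Twist records, ASSEMBLED: a landed `certL` row + the bins identification + the class binders ⟹ `BSD(E,p)`
# on X6 / X7 (rank 0 and rank 1), through the tree's `kuriharaNumber`

Cell `b2b-bsdres`, supersingular family, prover A = unit `b2b-bsdres-x10b` (gen 10).  Topic file; namespace
`Summit.BirchSwinnertonDyer.Rank1Residual.Supersingular`.  THEOREMS ONLY (compositions by name); no named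
fact, nothing asserted about any curve, nothing booked; X6 / X7 stay CONSTRUCTION-SHAPED; marks unchanged.

HONEST FRAMING (run/shared/lean/b2b/bsd-rank1-residual/, verbatim in every file): the goal of the
cell is to DELETE the COMBINATION-SHAPED residual classes of the Birch–Swinnerton-Dyer formula for
ALL analytic-rank `≤ 1` elliptic curves over `ℚ` — "full BSD formula for every rank `≤ 1` curve in
class `C`" assembled STRICTLY from published theorems — so that the rank-`≤ 1` remainder becomes
exactly the CONSTRUCTION-SHAPED classes, which are TYPED (missing-input `Prop`s), NOT attempted.
This is not "finishing BSD".

## What this file proves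

The per-pair consumers `X6.bsdp_of_kim_rankZero_of_kuriharaNumber_ne_zero` (`X6KuriharaRoute.lean`),
`X7.bsdp_of_kim_rank{Zero,One}_…`, `X6.bsdp_of_kim_rankOne_…` (`X7KuriharaRoute.lean`) take
`hδ : kuriharaNumber f (p^1) n ψ ≠ 0`.  `KuriharaTwistSymbolKurihara.lean` derives that `hδ` from a twist
record passing the schema's recheck PLUS the single identification hypothesis `hbins` (recorded bins `=`
`D·c_∞·` plus-symbol bins).  This file composes the two, so that a LANDED record theorem is consumed in one
step: for a record `r` in a `CertifiedL` list (the statement of every `certL_…` theorem of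
`Supersingular/*KuriharaTwistRecords*.lean`), with `ν = #primes < p` and `ω(r.n) = ν`,
* `X6.bsdp_rankZero_of_certifiedL` — X6 ∧ `r_an = 0` ∧ `p ≥ 5` ∧ `p ∤ ∏c`: `CertifiedL rs`, `r ∈ rs`, `hbins`,
  the curve-side binders of the consumer (`IsNewformOf`, `Kato.IsKolyvaginProduct W p 1 r.n`, cyclic
  `p`-parts at the level primes, surjective `ψ`) and its four published named facts ⟹ `BSDp W r.p`;
* `X7.bsdp_rankZero_of_certifiedL` — the same on X7 with surj(p);
* `X7.bsdp_rankOne_of_certifiedL`, `X6.bsdp_rankOne_of_certifiedL` — rank one, PRIME level `r.n = ℓ`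
  (`ν = 1`), exact `#Ш_an = q` with `ord_p q = 0`.
Nothing new is claimed: these are compositions; the non-kernel inputs per pair are exactly `hbins`
(numerics + rounding certificate + period identification) and the consumers' binders, as listed in their
docstrings.  Irreducibility for the integrality step comes from the class (`ClassX6.irr` / `ClassX7.irr`).

References: `KuriharaTwistSymbolKurihara.lean` (this seat); `X6KuriharaRoute.lean`, `X7KuriharaRoute.lean`
(gens 4–6); C.-H. Kim, arXiv:2203.12159 Thm. 1.9 (6) [Kim2022StructureSelmer]; HOME X6-KURIHARA.md §10.
-/

noncomputable section

open scoped Classical MatrixGroups ModularForm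

open CongruenceSubgroup WeierstrassCurve Literature.NumberTheory.EllipticCurves
  Literature.NumberTheory.EllipticCurves.ModularForms
  Literature.NumberTheory.EllipticCurves.Rank1Residual
  Literature.NumberTheory.EllipticCurves.Rank1Residual.Typed
  Summit.BirchSwinnertonDyer.Rank1Residual.Supersingular.KuriharaTwist

namespace Summit.BirchSwinnertonDyer.Rank1Residual.Supersingular

variable (W : WeierstrassCurve ℚ) [W.IsElliptic] [W.IsGloballyMinimal]

/-- **X6 ∧ `r_an = 0` ∧ `p ≥ 5` ∧ `p ∤ ∏c`: `BSD(E,p)` from a LANDED twist record.**  `r` a record of a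
`CertifiedL` list with `#primes < p` and `ω(r.n) = #primes`; `f` the newform of `E = W`; `r.n ∈ 𝒩_1(E, r.p)`
with cyclic `p`-parts; surjective discrete logarithms `ψ`; the identification `hbins`; and the consumer's
published facts (Kim 2026 Thm. 1.8 (6), period transfer, GZK, modularity) ⟹ `BSDp W r.p`.  Per pair; NOT a
class theorem; nothing booked. [cite: Kim2022StructureSelmer, Thm. 1.9 (6) (PDF p. 8), Cor. 1.6] -/
theorem X6.bsdp_rankZero_of_certifiedL
    (hKim : Kim2022_rankZero_padicValRat_sha_of_kuriharaNumber_ne_zero)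
    (hϖ : realPeriodRat_eq_unit_mul_plusPeriod)
    (hGZK : rank_eq_analyticRank_of_analyticRank_le_one) (hmod : hasEntireLFunction_rat)
    {rs : List TwistRecord} (hrs : CertifiedL rs) {r : TwistRecord} (hr : r ∈ rs) [Fact r.p.Prime]
    (hνp : r.primes.length < r.p) [NeZero r.n] (hν : r.n.primeFactors.card = r.primes.length)
    (hp : 5 ≤ r.p) (hX : ClassX6 W r.p) (hr0 : W.analyticRank = 0) (htam : ¬ r.p ∣ W.tamagawaProduct)
    {N : ℕ} [NeZero N] (f : CuspForm (Gamma0 N) 2) (hf : IsNewformOf W f)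
    (hn : Kato.IsKolyvaginProduct W r.p 1 r.n)
    (hcyc : ∀ (ℓ : ℕ) [Fact ℓ.Prime], ℓ ∣ r.n →
      Nat.card {P : ((WeierstrassCurve.integralModelInt W).map
          (Int.castRingHom (ZMod ℓ))).toAffine.Point // r.p • P = 0} ≤ r.p)
    (ψ : (ℓ : ℕ) → (ZMod ℓ)ˣ →* Multiplicative (ZMod (r.p ^ 1)))
    (hψ : ∀ ℓ ∈ r.n.primeFactors, Function.Surjective (ψ ℓ))
    (hbins : ∀ j < r.p, ((r.bins.getD j 0 : ℤ) : ℚ) = (r.den : ℚ) * (r.components : ℚ) *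
      ∑ a ∈ (Finset.univ : Finset (ZMod r.n)ˣ).filter (fun a =>
        (∑ ℓ ∈ r.n.primeFactors.attach, Multiplicative.toAdd
          (ψ ℓ.1 (ZMod.unitsMap (Nat.dvd_of_mem_primeFactors ℓ.2) a))).val = j),
        ratPlusSymbol f ((((a : ZMod r.n).val : ℕ) : ℚ) / (r.n : ℚ))) :
    BSDp W r.p :=
  have hp2 : r.p ≠ 2 := by omega
  X6.bsdp_of_kim_rankZero_of_kuriharaNumber_ne_zero W r.p hKim hϖ hGZK hmod hp hX hr0 htam f hf r.n hn
    hcyc ψ hψ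
    (r.kuriharaNumber_ne_zero_of_consistent_of_isNewformOf (hrs.consistent_of_mem hr)
      (hrs.deltaModP_pos_of_mem hr) hνp hν hf hp2 (ClassX6.irr W r.p hp2 hX) hn ψ hbins)

/-- **X7 ∧ `r_an = 0` ∧ `p ≥ 5` ∧ surj(p) ∧ `p ∤ ∏c`: `BSD(E,p)` from a LANDED twist record** (as
`X6.bsdp_rankZero_of_certifiedL`, with the surjectivity binder of the X7 consumer). Per pair; nothing booked.
[cite: Kim2022StructureSelmer, Thm. 1.9 (6) (PDF p. 8), Cor. 1.6] -/
theorem X7.bsdp_rankZero_of_certifiedL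
    (hKim : Kim2022_rankZero_padicValRat_sha_of_kuriharaNumber_ne_zero)
    (hϖ : realPeriodRat_eq_unit_mul_plusPeriod)
    (hGZK : rank_eq_analyticRank_of_analyticRank_le_one) (hmod : hasEntireLFunction_rat)
    {rs : List TwistRecord} (hrs : CertifiedL rs) {r : TwistRecord} (hr : r ∈ rs) [Fact r.p.Prime]
    (hνp : r.primes.length < r.p) [NeZero r.n] (hν : r.n.primeFactors.card = r.primes.length)
    (hp : 5 ≤ r.p) (hX : ClassX7 W r.p) (hsurj : Surj W r.p) (hr0 : W.analyticRank = 0)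
    (htam : ¬ r.p ∣ W.tamagawaProduct)
    {N : ℕ} [NeZero N] (f : CuspForm (Gamma0 N) 2) (hf : IsNewformOf W f)
    (hn : Kato.IsKolyvaginProduct W r.p 1 r.n)
    (hcyc : ∀ (ℓ : ℕ) [Fact ℓ.Prime], ℓ ∣ r.n →
      Nat.card {P : ((WeierstrassCurve.integralModelInt W).map
          (Int.castRingHom (ZMod ℓ))).toAffine.Point // r.p • P = 0} ≤ r.p)
    (ψ : (ℓ : ℕ) → (ZMod ℓ)ˣ →* Multiplicative (ZMod (r.p ^ 1)))
    (hψ : ∀ ℓ ∈ r.n.primeFactors, Function.Surjective (ψ ℓ))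
    (hbins : ∀ j < r.p, ((r.bins.getD j 0 : ℤ) : ℚ) = (r.den : ℚ) * (r.components : ℚ) *
      ∑ a ∈ (Finset.univ : Finset (ZMod r.n)ˣ).filter (fun a =>
        (∑ ℓ ∈ r.n.primeFactors.attach, Multiplicative.toAdd
          (ψ ℓ.1 (ZMod.unitsMap (Nat.dvd_of_mem_primeFactors ℓ.2) a))).val = j),
        ratPlusSymbol f ((((a : ZMod r.n).val : ℕ) : ℚ) / (r.n : ℚ))) :
    BSDp W r.p :=
  have hp2 : r.p ≠ 2 := by omega
  X7.bsdp_of_kim_rankZero_of_kuriharaNumber_ne_zero W r.p hKim hϖ hGZK hmod hp hX hsurj hr0 htam f hf r.n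
    hn hcyc ψ hψ
    (r.kuriharaNumber_ne_zero_of_consistent_of_isNewformOf (hrs.consistent_of_mem hr)
      (hrs.deltaModP_pos_of_mem hr) hνp hν hf hp2 (ClassX7.irr W r.p hp2 hX) hn ψ hbins)

/-- **X7 ∧ `r_an = 1` ∧ `p ≥ 5` ∧ surj(p), `ord_p #Ш_an = 0`: `BSD(E,p)` from a LANDED twist record at a PRIME
level `r.n = ℓ`** (`ν = 1`; the X7 rank-one consumer). Per pair; nothing booked.
[cite: Kim2022StructureSelmer, Thm. 1.9 (6) (PDF p. 8), Cor. 1.6] -/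
theorem X7.bsdp_rankOne_of_certifiedL
    (hKim : Kim2022_rankOne_card_sha_eq_one_of_kuriharaNumber_ne_zero)
    (hϖ : realPeriodRat_eq_unit_mul_plusPeriod)
    (hGZK : rank_eq_analyticRank_of_analyticRank_le_one) (hmod : hasEntireLFunction_rat)
    {rs : List TwistRecord} (hrs : CertifiedL rs) {r : TwistRecord} (hr : r ∈ rs) [Fact r.p.Prime]
    [Fact r.n.Prime] (hνp : r.primes.length < r.p) (hν : r.n.primeFactors.card = r.primes.length)
    (hp : 5 ≤ r.p) (hX : ClassX7 W r.p) (hsurj : Surj W r.p) (hr1 : W.analyticRank = 1)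
    {q : ℚ} (hq : shaAn W = (q : ℂ)) (hv : padicValRat r.p q = 0)
    {N : ℕ} [NeZero N] (f : CuspForm (Gamma0 N) 2) (hf : IsNewformOf W f)
    (hℓ : Kato.IsKolyvaginPrime W r.p 1 r.n)
    (hcyc : Nat.card {P : ((WeierstrassCurve.integralModelInt W).map
        (Int.castRingHom (ZMod r.n))).toAffine.Point // r.p • P = 0} ≤ r.p)
    (ψ : (ℓ' : ℕ) → (ZMod ℓ')ˣ →* Multiplicative (ZMod (r.p ^ 1)))
    (hψ : Function.Surjective (ψ r.n))
    (hbins : ∀ j < r.p, ((r.bins.getD j 0 : ℤ) : ℚ) = (r.den : ℚ) * (r.components : ℚ) *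
      ∑ a ∈ (Finset.univ : Finset (ZMod r.n)ˣ).filter (fun a =>
        (∑ ℓ ∈ r.n.primeFactors.attach, Multiplicative.toAdd
          (ψ ℓ.1 (ZMod.unitsMap (Nat.dvd_of_mem_primeFactors ℓ.2) a))).val = j),
        ratPlusSymbol f ((((a : ZMod r.n).val : ℕ) : ℚ) / (r.n : ℚ))) :
    BSDp W r.p :=
  have hp2 : r.p ≠ 2 := by omega
  X7.bsdp_of_kim_rankOne_of_kuriharaNumber_ne_zero W r.p hKim hϖ hGZK hmod hp hX hsurj hr1 hq hv f hf r.n hℓ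
    hcyc ψ hψ
    (r.kuriharaNumber_ne_zero_of_consistent_of_isNewformOf (hrs.consistent_of_mem hr)
      (hrs.deltaModP_pos_of_mem hr) hνp hν hf hp2 (ClassX7.irr W r.p hp2 hX) hℓ.isKolyvaginProduct ψ
      hbins)

/-- **X6 ∧ `r_an = 1` ∧ `p ≥ 5`, `ord_p #Ш_an = 0`: `BSD(E,p)` from a LANDED twist record at a PRIME level
`r.n = ℓ`** (the X6 rank-one twin). Per pair; nothing booked.
[cite: Kim2022StructureSelmer, Thm. 1.9 (6) (PDF p. 8), Cor. 1.6] -/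
theorem X6.bsdp_rankOne_of_certifiedL
    (hKim : Kim2022_rankOne_card_sha_eq_one_of_kuriharaNumber_ne_zero)
    (hϖ : realPeriodRat_eq_unit_mul_plusPeriod)
    (hGZK : rank_eq_analyticRank_of_analyticRank_le_one) (hmod : hasEntireLFunction_rat)
    {rs : List TwistRecord} (hrs : CertifiedL rs) {r : TwistRecord} (hr : r ∈ rs) [Fact r.p.Prime]
    [Fact r.n.Prime] (hνp : r.primes.length < r.p) (hν : r.n.primeFactors.card = r.primes.length)
    (hp : 5 ≤ r.p) (hX : ClassX6 W r.p) (hr1 : W.analyticRank = 1)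
    {q : ℚ} (hq : shaAn W = (q : ℂ)) (hv : padicValRat r.p q = 0)
    {N : ℕ} [NeZero N] (f : CuspForm (Gamma0 N) 2) (hf : IsNewformOf W f)
    (hℓ : Kato.IsKolyvaginPrime W r.p 1 r.n)
    (hcyc : Nat.card {P : ((WeierstrassCurve.integralModelInt W).map
        (Int.castRingHom (ZMod r.n))).toAffine.Point // r.p • P = 0} ≤ r.p)
    (ψ : (ℓ' : ℕ) → (ZMod ℓ')ˣ →* Multiplicative (ZMod (r.p ^ 1)))
    (hψ : Function.Surjective (ψ r.n))
    (hbins : ∀ j < r.p, ((r.bins.getD j 0 : ℤ) : ℚ) = (r.den : ℚ) * (r.components : ℚ) *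
      ∑ a ∈ (Finset.univ : Finset (ZMod r.n)ˣ).filter (fun a =>
        (∑ ℓ ∈ r.n.primeFactors.attach, Multiplicative.toAdd
          (ψ ℓ.1 (ZMod.unitsMap (Nat.dvd_of_mem_primeFactors ℓ.2) a))).val = j),
        ratPlusSymbol f ((((a : ZMod r.n).val : ℕ) : ℚ) / (r.n : ℚ))) :
    BSDp W r.p :=
  have hp2 : r.p ≠ 2 := by omega
  X6.bsdp_of_kim_rankOne_of_kuriharaNumber_ne_zero W r.p hKim hϖ hGZK hmod hp hX hr1 hq hv f hf r.n hℓ hcyc ψ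
    hψ
    (r.kuriharaNumber_ne_zero_of_consistent_of_isNewformOf (hrs.consistent_of_mem hr)
      (hrs.deltaModP_pos_of_mem hr) hνp hν hf hp2 (ClassX6.irr W r.p hp2 hX) hℓ.isKolyvaginProduct ψ
      hbins)

end Summit.BirchSwinnertonDyer.Rank1Residual.Supersingular
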